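import Summits.ValiantsHypothesis.ValiantsHypothesis.Theorems.TwoProducts.RankThreeAffineUnitLadder

/-!
# Rank three AFFINE, T1-E: BOUNDED FEWNOMIALS are tame, UNIFORMLY in exponents and coefficients — `nv (P(w)) ≤ Φ_r(t)` for `|supp P| ≤ r`

Located CLASS of the OPEN rung 3-AFF (`…Cruxes.TwoProducts.ValIdea35g10.RankThreeAffineLaw`) of the SIDE ladder «table-rank-ladder» of crux
`stmt-ValiantsHypothesis-5906` (`TwoProducts`): for every outer polynomial `P ∈ ℂ[X₀,X₁,X₂]` with AT MOST `r` MONOMIALS — arbitrary (mixed) exponents, arbitrary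
coefficients — and `t`-sparse carriers `w : Fin 3 → ℂ[x,y]`,
★★ `fewnomialAffine_nv_le : nv (MvPolynomial.aeval w P) ≤ fewBound r t`, `fewBound r t = 2·ladderBound t t³ (3t⁴) (3t²) r 1 + 4` — polynomial in `t` for each FIXED `r`
(degree `~ 2^r`; `≤ (t+2)^(8·ladderExp r + 3)`, `ladderExp (n+1) = 6·ladderExp n + 1`), no hypothesis
on `P` beyond its number of monomials, none on `w` beyond sparsity (zero / constant carriers handled inside).  So on rung 3-AFF an escape can only come from a
GROWING NUMBER of monomials of the outer polynomial — never from degrees or coefficients alone (val-port-1 g5; priced by val-idea-crit-8 g5 VERDICT #79,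
conditions (E1)–(E7)).  Contains the binomial node T1-A (✓ `…RankThreeAffineBinomial`, r = 2) and the trinomial node T1-A′ (✓ `…RankThreeAffineTrinomial`, r = 3)
as instances with worse constants; neither is restated or used.
THE PROOF = ✓ `card_Eset_unitSum_le` (`…RankThreeAffineUnitLadder`) with the UNITS `U_α = w₀^{α₀}·w₁^{α₁}·w₂^{α₂}` (`|Eset| ≤ 3t²` by ✓ `ostrowski`), `M = w₀w₁w₂`,
the three-factor bracket `M·J(U_α, v) = U_α·L_α`, `L_α = α₀·w₁w₂·J(w₀,v) + α₁·w₀w₂·J(w₁,v) + α₂·w₀w₁·J(w₂,v)` (≤ 3t⁴ terms; `bracket_identity3`), constant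
coefficients `C(coeff α P)` (s = 1), and `P(w) = Σ_{α ∈ supp P} U_α·C(coeff α P)` (`MvPolynomial.as_sum`, `aeval_monomial`); zero carriers are replaced by `1` on
the monomials that avoid them (`aeval_eq_unitSum`), and all-constant carriers give a constant (✓ `Eset_C`).
Also `def FewnomialAffineLaw : Prop := ∀ r, ∃ c, ∀ t P w, |supp P| ≤ r → (∀ i, |supp (w i)| ≤ t) → nv (aeval w P) ≤ (t+2)^c` + ★ `fewnomialAffineLaw` (`c = 8·ladderExp r + 3`, via `ladderBound_le_pow`).
PRINT LINE (val-idea-crit-8 g5 VERDICT #79, wording theirs).  T1-E is the NEWTON-POLYGON ANALOGUE of Grenet–Koiran–Portier–Strozecki 2011, Thm 1 (arXiv:1107.1434,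
p.6: the number of real roots of `Σ_{i≤k} Π_{j≤m} f_j^{α_ij}` is `≤ C·((m+2)t^m)^{2^{k−1}−1}` — doubly exponential in the number of terms, by the same
divide-by-a-term-and-differentiate ladder; here `m = 3` letters, `k = r`, the derivative is `J(·,v)` and Rolle is replaced by the ✓ shifted axial transfer
`Eset_subset_of_shifted`); the better print technology is Koiran–Portier–Tavenas 2015, Thm 12 (arXiv:1205.1015, p.6: `≤ 4ktm + 4(e(1+t))^{mk²/2}`, Wronskian),
whose Newton-polygon analogue `t^{O(r²)}` is NOT attempted here (T1-E′); KPTT 2015 Thm 6 (arXiv:1308.2286, p.7, `O(k·t^{2m/3})`) is NOT uniform in the exponents;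
the rung `RankThreeAffineLaw` = polynomial dependence on `r`.  Novelty grade of record: VARIANT (GKPS11's mechanism in the Newton-polygon setting; the non-print
ingredient is the already-landed ✓ engine).
HONEST LABEL: located CLASS of the OPEN rung 3-AFF («bounded fewnomials»); NOT γ — the rung's law asks `poly(m,t)` while `r` can be `~ m³` and the ladder costs
`t^{O(2^r)}`; `RankThreeAffineLaw(Exp)` / `TwoProducts` (there `n = 2m` letters and the unit numerators have `~ m·t^{m+1}` terms) / `PlanarCellBound` /
`ResidualLawV25` UNMOVED; 0 summit distance; VP ≠ VNP is NOT proved here or anywhere in this tree.  `--supports stmt-ValiantsHypothesis-5906 --as helper`.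
No instances, no notation, no named facts. [folklore]
-/

noncomputable section
set_option linter.dupNamespace false

namespace Summit.ValiantsHypothesis.ValiantsHypothesis.Theorems.TwoProducts.RankTwoJacobian

open scoped BigOperators Pointwise Classical
open MvPolynomial

/-! ### §1 The units `w₀^a·w₁^b·w₂^d`: bracket identity, numerator size, edge count -/

/-- **Three-factor bracket identity:** `w₀w₁w₂·J(w₀^a w₁^b w₂^d, v) = (w₀^a w₁^b w₂^d)·(a·w₁w₂·J(w₀,v) + b·w₀w₂·J(w₁,v) + d·w₀w₁·J(w₂,v))` (three ✓ `jac_pow_mul`). [folklore] -/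
theorem bracket_identity3 (w₀ w₁ w₂ v : Poly2) (a b d : ℕ) :
    w₀ * w₁ * w₂ * jac (w₀ ^ a * w₁ ^ b * w₂ ^ d) v =
      (w₀ ^ a * w₁ ^ b * w₂ ^ d) * (C (a : ℂ) * (w₁ * w₂ * jac w₀ v) + C (b : ℂ) * (w₀ * w₂ * jac w₁ v) + C (d : ℂ) * (w₀ * w₁ * jac w₂ v)) := by
  rw [jac_mul_left, jac_mul_left]
  have h0 := jac_pow_mul w₀ v a
  have h1 := jac_pow_mul w₁ v b
  have h2 := jac_pow_mul w₂ v d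
  linear_combination (w₁ * w₂ * w₁ ^ b * w₂ ^ d) * h0 + (w₀ * w₂ * w₀ ^ a * w₂ ^ d) * h1 + (w₀ * w₁ * w₀ ^ a * w₁ ^ b) * h2

/-- Size of the numerator: `≤ 3t⁴` terms. [folklore] -/
theorem card_support_bracket3_le {t : ℕ} (w₀ w₁ w₂ v : Poly2) (h0 : w₀.support.card ≤ t) (h1 : w₁.support.card ≤ t)
    (h2 : w₂.support.card ≤ t) (hv : v.support.card ≤ t) (a b d : ℕ) :
    (C (a : ℂ) * (w₁ * w₂ * jac w₀ v) + C (b : ℂ) * (w₀ * w₂ * jac w₁ v) + C (d : ℂ) * (w₀ * w₁ * jac w₂ v)).support.card ≤ 3 * t ^ 4 := by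
  have e4 : t * t * (t * t) = t ^ 4 := by ring
  have k0 : (C (a : ℂ) * (w₁ * w₂ * jac w₀ v)).support.card ≤ t ^ 4 := by
    refine (card_supp_C_mul_le _ _).trans ((card_supp_mul_le _ _).trans ?_)
    rw [← e4]
    exact Nat.mul_le_mul ((card_supp_mul_le _ _).trans (Nat.mul_le_mul h1 h2)) ((card_support_jac_le _ _).trans (Nat.mul_le_mul h0 hv))
  have k1 : (C (b : ℂ) * (w₀ * w₂ * jac w₁ v)).support.card ≤ t ^ 4 := by
    refine (card_supp_C_mul_le _ _).trans ((card_supp_mul_le _ _).trans ?_)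
    rw [← e4]
    exact Nat.mul_le_mul ((card_supp_mul_le _ _).trans (Nat.mul_le_mul h0 h2)) ((card_support_jac_le _ _).trans (Nat.mul_le_mul h1 hv))
  have k2 : (C (d : ℂ) * (w₀ * w₁ * jac w₂ v)).support.card ≤ t ^ 4 := by
    refine (card_supp_C_mul_le _ _).trans ((card_supp_mul_le _ _).trans ?_)
    rw [← e4]
    exact Nat.mul_le_mul ((card_supp_mul_le _ _).trans (Nat.mul_le_mul h0 h1)) ((card_support_jac_le _ _).trans (Nat.mul_le_mul h2 hv))
  have s1 := card_supp_add_le (C (a : ℂ) * (w₁ * w₂ * jac w₀ v)) (C (b : ℂ) * (w₀ * w₂ * jac w₁ v))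
  have s2 := card_supp_add_le (C (a : ℂ) * (w₁ * w₂ * jac w₀ v) + C (b : ℂ) * (w₀ * w₂ * jac w₁ v)) (C (d : ℂ) * (w₀ * w₁ * jac w₂ v))
  omega

/-- Units are TAME: `|Eset σ (w₀^a·w₁^b·w₂^d)| ≤ 3t²` for nonzero `t`-sparse carriers (✓ `ostrowski` via ✓ `Eset_mul_subset`, ✓ `Eset_pow_subset`). [folklore] -/
theorem card_Eset_unit3_le {σ : ℝ} (hσ : σ = 1 ∨ σ = -1) {t : ℕ} (w₀ w₁ w₂ : Poly2) (h0 : w₀.support.card ≤ t)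
    (h1 : w₁.support.card ≤ t) (h2 : w₂.support.card ≤ t) (n0 : w₀ ≠ 0) (n1 : w₁ ≠ 0) (n2 : w₂ ≠ 0) (a b d : ℕ) :
    (Eset σ (w₀ ^ a * w₁ ^ b * w₂ ^ d)).card ≤ 3 * (t * t) := by
  have hA : w₀ ^ a ≠ 0 := pow_ne_zero a n0
  have hB : w₁ ^ b ≠ 0 := pow_ne_zero b n1
  have hD : w₂ ^ d ≠ 0 := pow_ne_zero d n2
  have hsub : Eset σ (w₀ ^ a * w₁ ^ b * w₂ ^ d) ⊆ Eset σ w₀ ∪ Eset σ w₁ ∪ Eset σ w₂ :=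
    (Eset_mul_subset hσ (mul_ne_zero hA hB) hD).trans (Finset.union_subset_union
      ((Eset_mul_subset hσ hA hB).trans (Finset.union_subset_union (Eset_pow_subset hσ w₀ a) (Eset_pow_subset hσ w₁ b)))
      (Eset_pow_subset hσ w₂ d))
  have e0 := card_Eset_le_sq σ w₀ h0
  have e1 := card_Eset_le_sq σ w₁ h1
  have e2 := card_Eset_le_sq σ w₂ h2
  have := (Finset.card_le_card hsub).trans ((Finset.card_union_le _ _).trans (Nat.add_le_add (Finset.card_union_le _ _) le_rfl))
  omega

/-! ### §2 Monomial sums with nonzero carriers: the ladder instance -/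

/-- **Per chart, nonzero carriers, one of them non-constant:** for any finite set `K` of exponents and coefficients `c`,
`|Eset σ (Σ_{α∈K} w₀^{α₀} w₁^{α₁} w₂^{α₂} · C(c α))| ≤ ladderBound t t³ (3t⁴) (3t²) |K| 1`. -/
theorem card_Eset_monomialSum_le {σ : ℝ} (hσ : σ = 1 ∨ σ = -1) {t r : ℕ} (w : Fin 3 → Poly2)
    (hw : ∀ i, (w i).support.card ≤ t) (hw0 : ∀ i, w i ≠ 0) {i₀ : Fin 3} (hv : (S1 (w i₀)).Nonempty)
    (K : Finset (Fin 3 →₀ ℕ)) (c : (Fin 3 →₀ ℕ) → ℂ) (hK : K.card ≤ r) :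
    (Eset σ (∑ α ∈ K, (w 0 ^ α 0 * w 1 ^ α 1 * w 2 ^ α 2) * C (c α))).card ≤
      ladderBound t (t ^ 3) (3 * t ^ 4) (3 * (t * t)) r 1 := by
  have hM : w 0 * w 1 * w 2 ≠ 0 := mul_ne_zero (mul_ne_zero (hw0 0) (hw0 1)) (hw0 2)
  have hμ : (w 0 * w 1 * w 2).support.card ≤ t ^ 3 := by
    have := (card_supp_mul_le (w 0 * w 1) (w 2)).trans (Nat.mul_le_mul ((card_supp_mul_le (w 0) (w 1)).trans (Nat.mul_le_mul (hw 0) (hw 1))) (hw 2))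
    have e : t * t * t = t ^ 3 := by ring
    omega
  refine card_Eset_unitSum_le hσ hv (hw i₀) hM hμ
    (fun α : Fin 3 →₀ ℕ => w 0 ^ α 0 * w 1 ^ α 1 * w 2 ^ α 2)
    (fun α : Fin 3 →₀ ℕ => C ((α 0 : ℕ) : ℂ) * (w 1 * w 2 * jac (w 0) (w i₀)) + C ((α 1 : ℕ) : ℂ) * (w 0 * w 2 * jac (w 1) (w i₀)) +
      C ((α 2 : ℕ) : ℂ) * (w 0 * w 1 * jac (w 2) (w i₀)))
    (fun α => mul_ne_zero (mul_ne_zero (pow_ne_zero _ (hw0 0)) (pow_ne_zero _ (hw0 1))) (pow_ne_zero _ (hw0 2)))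
    (fun α => bracket_identity3 (w 0) (w 1) (w 2) (w i₀) (α 0) (α 1) (α 2))
    (fun α => card_support_bracket3_le (w 0) (w 1) (w 2) (w i₀) (hw 0) (hw 1) (hw 2) (hw i₀) (α 0) (α 1) (α 2))
    (fun α => card_Eset_unit3_le hσ (w 0) (w 1) (w 2) (hw 0) (hw 1) (hw 2) (hw0 0) (hw0 1) (hw0 2) (α 0) (α 1) (α 2))
    r K (fun α => C (c α)) 1 hK (fun α _ => ?_)
  rw [C_apply]
  exact (Finset.card_le_card support_monomial_subset).trans (by simp)

/-! ### §3 `P(w)` as a unit sum; zero carriers replaced by `1` on the monomials avoiding them -/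

/-- the carrier family with zero carriers replaced by `1` -/
def fixZero (w : Fin 3 → Poly2) : Fin 3 → Poly2 := fun i => if w i = 0 then 1 else w i

/-- `fixZero w i ≠ 0`. [folklore] -/
theorem fixZero_ne_zero (w : Fin 3 → Poly2) (i : Fin 3) : fixZero w i ≠ 0 := by
  unfold fixZero
  split_ifs with h
  · exact one_ne_zero
  · exact h

/-- Powers agree on exponents that vanish where the carrier vanishes. [folklore] -/
theorem fixZero_pow_eq (w : Fin 3 → Poly2) (i : Fin 3) (n : ℕ) (h : w i = 0 → n = 0) : fixZero w i ^ n = w i ^ n := by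
  unfold fixZero
  split_ifs with hz
  · rw [h hz, pow_zero, pow_zero]
  · rfl

/-- **`P(w)` as a unit sum over the monomials that avoid the zero carriers**, with the zero carriers replaced by `1`:
`aeval w P = Σ_{α ∈ supp P, αᵢ = 0 wherever wᵢ = 0} (w′₀^{α₀} w′₁^{α₁} w′₂^{α₂}) · C(coeff α P)`, `w′ = fixZero w`. [folklore] -/
theorem aeval_eq_unitSum (w : Fin 3 → Poly2) (P : Poly3) :
    MvPolynomial.aeval w P = ∑ α ∈ P.support.filter (fun α => ∀ i, w i = 0 → α i = 0),
      (fixZero w 0 ^ α 0 * fixZero w 1 ^ α 1 * fixZero w 2 ^ α 2) * C (coeff α P) := by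
  have hmon : ∀ α : Fin 3 →₀ ℕ, MvPolynomial.aeval w (monomial α (coeff α P)) = (w 0 ^ α 0 * w 1 ^ α 1 * w 2 ^ α 2) * C (coeff α P) := by
    intro α
    rw [MvPolynomial.aeval_monomial, MvPolynomial.algebraMap_eq, Finsupp.prod_fintype _ _ (fun i => pow_zero (w i)), Fin.prod_univ_three, mul_comm]
  conv_lhs => rw [P.as_sum, map_sum]
  rw [← Finset.sum_filter_add_sum_filter_not P.support (fun α => ∀ i, w i = 0 → α i = 0)]
  have hzero : ∑ α ∈ P.support.filter (fun α => ¬ ∀ i, w i = 0 → α i = 0), MvPolynomial.aeval w (monomial α (coeff α P)) = 0 := by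
    refine Finset.sum_eq_zero fun α hα => ?_
    obtain ⟨-, hnot⟩ := Finset.mem_filter.mp hα
    push Not at hnot
    obtain ⟨i, hi, hαi⟩ := hnot
    rw [hmon]
    have hz : w i ^ α i = 0 := by rw [hi, zero_pow hαi]
    have hprod : w 0 ^ α 0 * w 1 ^ α 1 * w 2 ^ α 2 = 0 := by
      fin_cases i
      · simp only [Fin.zero_eta] at hz; rw [hz, zero_mul, zero_mul]
      · simp only [Fin.mk_one] at hz; rw [hz, mul_zero, zero_mul]
      · simp only [Fin.reduceFinMk] at hz; rw [hz, mul_zero]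
    rw [hprod, zero_mul]
  rw [hzero, add_zero]
  refine Finset.sum_congr rfl fun α hα => ?_
  obtain ⟨-, hgood⟩ := Finset.mem_filter.mp hα
  rw [hmon, fixZero_pow_eq w 0 (α 0) (hgood 0), fixZero_pow_eq w 1 (α 1) (hgood 1), fixZero_pow_eq w 2 (α 2) (hgood 2)]

/-- Sparsity of the fixed carriers when `t ≥ 1`. [folklore] -/
theorem card_support_fixZero_le {t : ℕ} (w : Fin 3 → Poly2) (hw : ∀ i, (w i).support.card ≤ t) (ht : 1 ≤ t) (i : Fin 3) :
    (fixZero w i).support.card ≤ t := by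
  unfold fixZero
  split_ifs with h
  · rw [MvPolynomial.support_one, Finset.card_singleton]; exact ht
  · exact hw i

/-! ### §4 The per-chart count and the headline -/

/-- ★ **Per chart:** for `P : ℂ[X₀,X₁,X₂]` with `≤ r` monomials and `t`-sparse carriers (no other hypothesis),
`|Eset σ (P(w))| ≤ ladderBound t t³ (3t⁴) (3t²) r 1`. -/
theorem card_Eset_fewnomial_le {σ : ℝ} (hσ : σ = 1 ∨ σ = -1) {r t : ℕ} (P : Poly3) (hP : P.support.card ≤ r)
    (w : Fin 3 → Poly2) (hw : ∀ i, (w i).support.card ≤ t) :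
    (Eset σ (MvPolynomial.aeval w P)).card ≤ ladderBound t (t ^ 3) (3 * t ^ 4) (3 * (t * t)) r 1 := by
  rw [aeval_eq_unitSum]
  set K := P.support.filter (fun α => ∀ i, w i = 0 → α i = 0) with hK
  have hKr : K.card ≤ r := (Finset.card_filter_le _ _).trans hP
  by_cases hnc : ∃ i, (S1 (fixZero w i)).Nonempty
  · obtain ⟨i₀, hi₀⟩ := hnc
    -- a non-constant fixed carrier is an original carrier with a non-zero exponent, so `t ≥ 1`
    have ht : 1 ≤ t := by
      obtain ⟨s, hs⟩ := hi₀
      have hs' := (mem_S1.mp hs).1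
      have hne : fixZero w i₀ = w i₀ := by
        unfold fixZero; split_ifs with hz
        · exfalso
          unfold fixZero at hs'; rw [if_pos hz, MvPolynomial.support_one, Finset.mem_singleton] at hs'
          exact (mem_S1.mp hs).2 hs'
        · rfl
      rw [hne] at hs'
      exact le_trans (Finset.card_pos.mpr ⟨s, hs'⟩) (hw i₀)
    exact card_Eset_monomialSum_le hσ (fixZero w) (card_support_fixZero_le w hw ht) (fixZero_ne_zero w) hi₀ K
      (fun α => coeff α P) hKr
  · -- all fixed carriers constant ⇒ the sum is a constant
    have hnc' : ∀ i, ¬ (S1 (fixZero w i)).Nonempty := fun i h => hnc ⟨i, h⟩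
    obtain ⟨c, hc⟩ : ∃ c : Fin 3 → ℂ, ∀ i, fixZero w i = C (c i) :=
      ⟨fun i => coeff 0 (fixZero w i), fun i => eq_C_of_S1_empty (hnc' i)⟩
    have hsum : ∑ α ∈ K, (fixZero w 0 ^ α 0 * fixZero w 1 ^ α 1 * fixZero w 2 ^ α 2) * C (coeff α P) =
        C (∑ α ∈ K, (c 0 ^ α 0 * c 1 ^ α 1 * c 2 ^ α 2) * coeff α P) := by
      rw [map_sum]
      refine Finset.sum_congr rfl fun α _ => ?_
      rw [hc 0, hc 1, hc 2, ← map_pow, ← map_pow, ← map_pow, ← map_mul, ← map_mul, ← map_mul]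
    rw [hsum, Eset_C]
    simp

/-- THE FEWNOMIAL BOUND `Φ_r(t) = 2·ladderBound t t³ (3t⁴) (3t²) r 1 + 4` (explicit, primitive recursive; `≤ (t+2)^(8·ladderExp r + 3)` by `fewnomialAffineLaw`). -/
def fewBound (r t : ℕ) : ℕ := 2 * ladderBound t (t ^ 3) (3 * t ^ 4) (3 * (t * t)) r 1 + 4

/-- ★★ **T1-E SETTLED (uniform in exponents and coefficients).** For every `P ∈ ℂ[X₀,X₁,X₂]` with at most `r` monomials and `t`-sparse carriers
`w₀, w₁, w₂ ∈ ℂ[x,y]`: `nv (P(w₀,w₁,w₂)) ≤ fewBound r t` — a polynomial in `t` for each fixed `r` (`r = 2, 3` recover the binomial / trinomial nodes up to constants). -/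
theorem fewnomialAffine_nv_le (r t : ℕ) (P : Poly3) (hP : P.support.card ≤ r) (w : Fin 3 → Poly2) (hw : ∀ i, (w i).support.card ≤ t) :
    nv (MvPolynomial.aeval w P) ≤ fewBound r t := by
  have h1 := card_Eset_fewnomial_le (σ := 1) (Or.inl rfl) P hP w hw
  have h2 := card_Eset_fewnomial_le (σ := -1) (Or.inr rfl) P hP w hw
  have h := nv_le (MvPolynomial.aeval w P)
  unfold fewBound
  omega

/-! ### §5 The law: a `(t+2)`-power for each fixed `r` -/

/-- exponent tower for the power form of the ladder bound: `e 0 = 1`, `e (n+1) = 6·e n + 1` -/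
def ladderExp : ℕ → ℕ
  | 0 => 1
  | n + 1 => 6 * ladderExp n + 1

/-- `1 ≤ ladderExp n`. [folklore] -/
theorem one_le_ladderExp (n : ℕ) : 1 ≤ ladderExp n := by
  cases n with
  | zero => simp [ladderExp]
  | succ n => simp [ladderExp]

/-- One-step arithmetic of the power form: with `X = t + μ + ℓ + η + s + 2`, the step cost is `≤ X^6` and the next base is `≤ X^6`. [folklore] -/
theorem ladder_pow_step (t μ ℓ η s X : ℕ) (hX : X = t + μ + ℓ + η + s + 2) :
    3 * (t * t + t) + 4 * η + 3 * (s * s) + 2 ≤ X ^ 6 ∧ t + μ + ℓ + η + 2 * s * s * (ℓ + μ * t) + 2 ≤ X ^ 6 := by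
  have hX2 : 2 ≤ X := by omega
  have ht : t ≤ X := by omega
  have hs : s ≤ X := by omega
  have hη : η ≤ X := by omega
  have hℓ : ℓ + μ + 2 ≤ X := by omega
  have hXX : X ≤ X * X := Nat.le_mul_of_pos_left X (by omega)
  have e6 : X ^ 6 = X * X * X * X * (X * X) := by ring
  constructor
  · -- `≤ 14·X² ≤ X⁴·X²`
    have h14 : 3 * (t * t + t) + 4 * η + 3 * (s * s) + 2 ≤ 14 * (X * X) := by
      have a1 : t * t ≤ X * X := Nat.mul_le_mul ht ht
      have a2 : s * s ≤ X * X := Nat.mul_le_mul hs hs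
      have a3 : t ≤ X * X := ht.trans hXX
      have a4 : η ≤ X * X := hη.trans hXX
      have a5 : 2 ≤ X * X := hX2.trans hXX
      omega
    have hp : 14 ≤ X * X * X * X := by
      have : 2 * 2 * 2 * 2 ≤ X * X * X * X :=
        Nat.mul_le_mul (Nat.mul_le_mul (Nat.mul_le_mul hX2 hX2) hX2) hX2
      omega
    calc 3 * (t * t + t) + 4 * η + 3 * (s * s) + 2 ≤ 14 * (X * X) := h14
      _ ≤ X * X * X * X * (X * X) := Nat.mul_le_mul_right _ hp
      _ = X ^ 6 := e6.symm
  · -- `ℓ + μt ≤ X²`, `2s² ≤ X³`, so the new size is `≤ X⁵` and the base `≤ X⁵ + X ≤ X⁶`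
    have b1 : ℓ + μ * t ≤ X * X := by
      have h1 := Nat.mul_le_mul_right X hℓ
      have h2 := Nat.mul_le_mul_left μ ht
      have h3 := Nat.le_mul_of_pos_right ℓ (show 0 < X by omega)
      nlinarith
    have b2 : 2 * s * s ≤ X * X * X := by
      have : 2 * s * s = 2 * (s * s) := by ring
      rw [this]
      have : 2 * (s * s) ≤ X * (X * X) := Nat.mul_le_mul hX2 (Nat.mul_le_mul hs hs)
      nlinarith
    have b3 : 2 * s * s * (ℓ + μ * t) ≤ X * X * X * (X * X) := Nat.mul_le_mul b2 b1
    have b4 : t + μ + ℓ + η + 2 ≤ X := by omega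
    have b5 : X * X * X * (X * X) + X ≤ X ^ 6 := by
      rw [e6]
      have : X * X * X * (X * X) * 2 ≤ X * X * X * X * (X * X) := by
        have := Nat.mul_le_mul_left (X * X * X * (X * X)) hX2
        nlinarith
      have hX5 : X ≤ X * X * X * (X * X) := by
        calc X = X * 1 * 1 * (1 * 1) := by ring
          _ ≤ X * X * X * (X * X) := by
            have h1 : 1 ≤ X := by omega
            exact Nat.mul_le_mul (Nat.mul_le_mul (Nat.mul_le_mul le_rfl h1) h1) (Nat.mul_le_mul h1 h1)
      omega
    omega

/-- **Power form of the ladder bound:** with `X = t + μ + ℓ + η + s + 2`, `ladderBound t μ ℓ η n s ≤ X ^ ladderExp n`. [folklore] -/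
theorem ladderBound_le_pow (t μ ℓ η : ℕ) : ∀ (n s : ℕ), ladderBound t μ ℓ η n s ≤ (t + μ + ℓ + η + s + 2) ^ ladderExp n
  | 0, s => by simp [ladderBound]
  | n + 1, s => by
    obtain ⟨X, hX⟩ : ∃ X, X = t + μ + ℓ + η + s + 2 := ⟨_, rfl⟩
    rw [← hX]
    have hX2 : 2 ≤ X := by omega
    obtain ⟨hstep, hbase⟩ := ladder_pow_step t μ ℓ η s X hX
    have ih := ladderBound_le_pow t μ ℓ η n (2 * s * s * (ℓ + μ * t))
    have hrec : ladderBound t μ ℓ η n (2 * s * s * (ℓ + μ * t)) ≤ X ^ (6 * ladderExp n) := by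
      rw [pow_mul]
      exact ih.trans (Nat.pow_le_pow_left hbase _)
    have hge : X ^ 6 ≤ X ^ (6 * ladderExp n) :=
      Nat.pow_le_pow_right (by omega) (by have := one_le_ladderExp n; omega)
    show 3 * (t * t + t) + 4 * η + 3 * (s * s) + 2 + ladderBound t μ ℓ η n (2 * s * s * (ℓ + μ * t)) ≤ X ^ ladderExp (n + 1)
    calc 3 * (t * t + t) + 4 * η + 3 * (s * s) + 2 + ladderBound t μ ℓ η n (2 * s * s * (ℓ + μ * t))
        ≤ X ^ (6 * ladderExp n) + X ^ (6 * ladderExp n) := Nat.add_le_add (hstep.trans hge) hrec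
      _ = X ^ (6 * ladderExp n) * 2 := by ring
      _ ≤ X ^ (6 * ladderExp n) * X := Nat.mul_le_mul_left _ hX2
      _ = X ^ ladderExp (n + 1) := by rw [ladderExp, pow_succ]

/-- The BOUNDED-FEWNOMIAL affine law: for each `r` an absolute `c` with `nv (P(w)) ≤ (t+2)^c` whenever `|supp P| ≤ r` and the carriers are `t`-sparse.
PROVED below (`fewnomialAffineLaw`). -/
def FewnomialAffineLaw : Prop :=
  ∀ r : ℕ, ∃ c : ℕ, ∀ (t : ℕ) (P : Poly3) (w : Fin 3 → Poly2), P.support.card ≤ r → (∀ i, (w i).support.card ≤ t) →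
    nv (MvPolynomial.aeval w P) ≤ (t + 2) ^ c

/-- Arithmetic: the ladder base `t + t³ + 3t⁴ + 3t² + 1 + 2 ≤ (t+2)^8`. [folklore] -/
theorem fewnomial_base_le (t : ℕ) : t + t ^ 3 + 3 * t ^ 4 + 3 * (t * t) + 1 + 2 ≤ (t + 2) ^ 8 := by
  have ht : t ≤ t + 2 := Nat.le_add_right t 2
  have h1 : 1 ≤ t + 2 := by omega
  have p4 : t ^ 4 ≤ (t + 2) ^ 4 := Nat.pow_le_pow_left ht 4
  have p3 : t ^ 3 ≤ (t + 2) ^ 4 := (Nat.pow_le_pow_left ht 3).trans (Nat.pow_le_pow_right h1 (by norm_num))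
  have p2 : t * t ≤ (t + 2) ^ 4 := by
    have := (Nat.pow_le_pow_left ht 2).trans (Nat.pow_le_pow_right h1 (by norm_num : 2 ≤ 4)); rwa [pow_two] at this
  have p1 : t ≤ (t + 2) ^ 4 := by
    have := (Nat.pow_le_pow_left ht 1).trans (Nat.pow_le_pow_right h1 (by norm_num : 1 ≤ 4)); rwa [pow_one] at this
  have p0 : 1 ≤ (t + 2) ^ 4 := Nat.one_le_pow _ _ h1
  have hs : t + t ^ 3 + 3 * t ^ 4 + 3 * (t * t) + 1 + 2 ≤ 11 * (t + 2) ^ 4 := by omega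
  have h11 : 11 ≤ (t + 2) ^ 4 := le_trans (by norm_num : 11 ≤ 2 ^ 4) (Nat.pow_le_pow_left (by omega) 4)
  calc _ ≤ 11 * (t + 2) ^ 4 := hs
    _ ≤ (t + 2) ^ 4 * (t + 2) ^ 4 := Nat.mul_le_mul_right _ h11
    _ = (t + 2) ^ 8 := by rw [← pow_add]

/-- ★ **`FewnomialAffineLaw` holds** (`c = 8·ladderExp r + 3`). -/
theorem fewnomialAffineLaw : FewnomialAffineLaw := by
  intro r
  refine ⟨8 * ladderExp r + 3, fun t P w hP hw => (fewnomialAffine_nv_le r t P hP w hw).trans ?_⟩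
  have hL := (ladderBound_le_pow t (t ^ 3) (3 * t ^ 4) (3 * (t * t)) r 1).trans
    (Nat.pow_le_pow_left (fewnomial_base_le t) (ladderExp r))
  rw [← pow_mul] at hL
  have h6 : 6 ≤ (t + 2) ^ 3 := le_trans (by norm_num : 6 ≤ 2 ^ 3) (Nat.pow_le_pow_left (by omega) 3)
  unfold fewBound
  calc 2 * ladderBound t (t ^ 3) (3 * t ^ 4) (3 * (t * t)) r 1 + 4
      ≤ 2 * (t + 2) ^ (8 * ladderExp r) + 4 * (t + 2) ^ (8 * ladderExp r) := by
        have hY : 1 ≤ (t + 2) ^ (8 * ladderExp r) := Nat.one_le_pow _ _ (by omega)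
        omega
    _ = (t + 2) ^ (8 * ladderExp r) * 6 := by ring
    _ ≤ (t + 2) ^ (8 * ladderExp r) * (t + 2) ^ 3 := Nat.mul_le_mul_left _ h6
    _ = (t + 2) ^ (8 * ladderExp r + 3) := by rw [← pow_add]

end Summit.ValiantsHypothesis.ValiantsHypothesis.Theorems.TwoProducts.RankTwoJacobian

end
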